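import Summits.CriticalPhenomena.CardyFormulaZ2.Theorems.StripClusterRates.Negative.SubmultiplicativeOne
import Literature.Probability.Percolation.CrossingChains
import Literature.Probability.Percolation.AnnulusCircuitsProofs
import Literature.Probability.Percolation.SiteMonotonicity
import Literature.Probability.Percolation.RSWProofs

/-!
# Band construction for the two-cluster event: independence of the three bands (stub B2)

Crux `Summit.CriticalPhenomena.CardyFormulaZ2.Theses.CardyBoundaryCoulombGas.StripClusterRates`
(stmt-CriticalPhenomena-13878), line `two-cluster-rate-is-stationary-gap`, stub
`band_real_inter_eq` of the band construction for the UPPER edge of the two-cluster window.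

In the rectangle `[0, m] × [0, a+b+c+3]` of `ℤ²` consider, for bond percolation at `p = 1/2`,
* `A = LR([0, m] × [0, a])` (`lrCrossing m a`), the bottom band, rows `0 … a`;
* `B = LR((0, a+c+3) + [0, m] × [0, b])` (`lrCrossingAt`), the top band, rows `a+c+3 … a+b+c+3`;
* `C = TB((0, a+1) + [0, m] × [0, c+1])`, the middle band, rows `a+1 … a+c+2`.

The three events are determined by the vertex-pair sets of three ROW-DISJOINT vertex sets, hence
are independent under the product measure (`bondPercolation_real_inter_of_disjoint`), and
`P(A ∩ B ∩ Cᶜ) = P(A) · P(B) · (1 - P(C)) = p₁(m, a) · p₁(m, b) · p₁(m+1, c)`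
by translation invariance (`bondPercolation_real_lrCrossingAt`,
`bondPercolation_real_tbCrossingAt`) and duality at the self-dual point
(`crossingProb_add_crossingProb_symm_holds`, `symm_half`):
`1 - crossingProb ½ (c+1) m = crossingProb ½ (m+1) c`.

Sources: folklore (Grimmett, *Percolation* (1999), §1.3 product measure, §11.2 duality;
Bollobás–Riordan, *Percolation* (2006), Ch. 3, Corollary 3(i)). No named unproved facts are used.
-/

noncomputable section

open MeasureTheory Filter Topology
open Literature.Probability.LatticeModels Literature.Probability.Percolation

namespace Summit.CriticalPhenomena.CardyFormulaZ2.Cruxes.StripClusterRates.TwoClusterRateIsStationaryGap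

open Summit.CriticalPhenomena.CardyFormulaZ2.Theorems.StripClusterRates.Negative
  (determinedBy_lrCrossingAt)

/-- The translated top-bottom crossing event of `u + [0, M] × [0, n]` is determined by the pairs
of vertices of the translated rectangle. [folklore] -/
theorem b2_determinedBy_tbCrossingAt (u : Site 2) (M n : ℕ) :
    DeterminedBy (openCrossing ((· + u) '' (rectangle M n : Set (Site 2)))
      ((· + u) '' (bottomSide M n : Set (Site 2))) ((· + u) '' (topSide M n : Set (Site 2))) :
        Set (BondConfig (Site 2))) ↑((rectangle M n).image (· + u)).sym2 := by
  have : ((· + u) '' (rectangle M n : Set (Site 2))) = ↑((rectangle M n).image (· + u)) :=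
    Finset.coe_image.symm
  rw [this]
  exact PlanarDuality.determinedBy_openCrossing _ _ _

/-- Vertex sets separated by a row level `k` (rows of `R₁` below `k`, rows of `R₂` at or above
`k`) have disjoint pair sets. [folklore] -/
theorem b2_disjoint_sym2_of_row {R₁ R₂ : Finset (Site 2)} (k : ℤ)
    (h₁ : ∀ z ∈ R₁, z 1 < k) (h₂ : ∀ z ∈ R₂, k ≤ z 1) :
    Disjoint (↑R₁.sym2 : Set (Sym2 (Site 2))) ↑R₂.sym2 := by
  rw [Finset.disjoint_coe, Finset.disjoint_left]
  intro e he he'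
  induction e using Sym2.ind with
  | _ x y =>
    have hx : x ∈ R₁ := Finset.mem_sym2_iff.1 he x (Sym2.mem_mk_left x y)
    have hx' : x ∈ R₂ := Finset.mem_sym2_iff.1 he' x (Sym2.mem_mk_left x y)
    exact absurd (h₁ x hx) (not_lt.2 (h₂ x hx'))

/-- Rows of the bottom band `[0, m] × [0, a]` lie below `a + 1`. [folklore] -/
theorem b2_row_lt_of_mem_rectangle (m a : ℕ) :
    ∀ z ∈ rectangle m a, z 1 < (a : ℤ) + 1 := by
  intro z hz
  rw [mem_rectangle_iff] at hz
  omega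

/-- Rows of the translated rectangle `(0, j) + [0, m] × [0, n]` lie in `[j, j + n]`. [folklore] -/
theorem b2_row_mem_of_mem_image (m n : ℕ) (j : ℤ) :
    ∀ z ∈ (rectangle m n).image (· + pt 0 j), j ≤ z 1 ∧ z 1 ≤ j + n := by
  intro z hz
  obtain ⟨w, hw, rfl⟩ := Finset.mem_image.1 hz
  rw [mem_rectangle_iff] at hw
  simp only [Pi.add_apply, Matrix.cons_val_one, Matrix.cons_val_fin_one]
  omega

/-- **Independence of the three bands and evaluation of the product**: for bond percolation on
`ℤ²` at `p = 1/2`, the probability of the event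
`LR(bottom a-band) ∩ LR(top b-band) ∩ (TB(middle (c+1)-band))ᶜ` is
`p₁(m,a) · p₁(m,b) · p₁(m+1,c)`, the last factor by self-duality
`1 - crossingProb ½ (c+1) m = crossingProb ½ (m+1) c`. [folklore] -/
theorem band_real_inter_eq : ∀ m a b c : ℕ, (bondPercolation (zdGraph 2) half).real
    (lrCrossing m a ∩ lrCrossingAt (pt 0 ((a : ℤ) + c + 3)) m b ∩
      (openCrossing ((· + pt 0 ((a : ℤ) + 1)) '' (rectangle m (c + 1) : Set (Site 2)))
        ((· + pt 0 ((a : ℤ) + 1)) '' (bottomSide m (c + 1) : Set (Site 2)))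
        ((· + pt 0 ((a : ℤ) + 1)) '' (topSide m (c + 1) : Set (Site 2))))ᶜ) =
    crossingProb half m a * crossingProb half m b * crossingProb half (m + 1) c := by
  intro m a b c
  -- the three events are determined by the pair sets of three row-disjoint vertex sets
  have hA : DeterminedBy (lrCrossing m a) (↑(rectangle m a).sym2 : Set (Sym2 (Site 2))) :=
    PlanarDuality.determinedBy_openCrossing (rectangle m a) _ _
  have hB := determinedBy_lrCrossingAt (pt 0 ((a : ℤ) + c + 3)) m b
  have hC := b2_determinedBy_tbCrossingAt (pt 0 ((a : ℤ) + 1)) m (c + 1)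
  have hAm := measurableSet_lrCrossing m a
  have hBm := measurableSet_lrCrossingAt (pt 0 ((a : ℤ) + c + 3)) m b
  have hCm := measurableSet_tbCrossingAt (pt 0 ((a : ℤ) + 1)) m (c + 1)
  have hRB := b2_row_mem_of_mem_image m b ((a : ℤ) + c + 3)
  have hRC := b2_row_mem_of_mem_image m (c + 1) ((a : ℤ) + 1)
  have hSAB : Disjoint (↑(rectangle m a).sym2 : Set (Sym2 (Site 2)))
      ↑((rectangle m b).image (· + pt 0 ((a : ℤ) + c + 3))).sym2 :=
    b2_disjoint_sym2_of_row ((a : ℤ) + 1) (b2_row_lt_of_mem_rectangle m a)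
      (fun z hz => by have := hRB z hz; omega)
  have hSAC : Disjoint (↑(rectangle m a).sym2 : Set (Sym2 (Site 2)))
      ↑((rectangle m (c + 1)).image (· + pt 0 ((a : ℤ) + 1))).sym2 :=
    b2_disjoint_sym2_of_row ((a : ℤ) + 1) (b2_row_lt_of_mem_rectangle m a)
      (fun z hz => (hRC z hz).1)
  have hSCB : Disjoint
      (↑((rectangle m (c + 1)).image (· + pt 0 ((a : ℤ) + 1))).sym2 : Set (Sym2 (Site 2)))
      ↑((rectangle m b).image (· + pt 0 ((a : ℤ) + c + 3))).sym2 :=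
    b2_disjoint_sym2_of_row ((a : ℤ) + c + 3) (fun z hz => by have := hRC z hz; omega)
      (fun z hz => (hRB z hz).1)
  have hSABC : Disjoint ((↑(rectangle m a).sym2 : Set (Sym2 (Site 2))) ∪
      ↑((rectangle m b).image (· + pt 0 ((a : ℤ) + c + 3))).sym2)
      ↑((rectangle m (c + 1)).image (· + pt 0 ((a : ℤ) + 1))).sym2 :=
    Set.disjoint_union_left.2 ⟨hSAC, hSCB.symm⟩
  -- independence, in two steps, then translation invariance and the complement rule
  rw [bondPercolation_real_inter_of_disjoint (zdGraph 2) half hSABC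
      ((hA.mono Set.subset_union_left).inter (hB.mono Set.subset_union_right)) hC.compl
      (hAm.inter hBm) hCm.compl,
    bondPercolation_real_inter_of_disjoint (zdGraph 2) half hSAB hA hB hAm hBm,
    bondPercolation_real_lrCrossingAt, probReal_compl_eq_one_sub hCm,
    bondPercolation_real_tbCrossingAt]
  -- duality at the self-dual point: `crossingProb ½ (m+1) c + crossingProb ½ (c+1) m = 1`
  have hdual := crossingProb_add_crossingProb_symm_holds half m c
  rw [symm_half] at hdual
  show crossingProb half m a * crossingProb half m b * (1 - crossingProb half (c + 1) m) = _
  rw [← hdual, add_sub_cancel_right]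

end Summit.CriticalPhenomena.CardyFormulaZ2.Cruxes.StripClusterRates.TwoClusterRateIsStationaryGap

end
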